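import Summits.QuantumFields.BalabanUV.Beta.EriceRemainderEnclosureHistoryAutonomyComparisonDefectMemoryProfile
import Summits.QuantumFields.BalabanUV.Beta.EriceRemainderEnclosureHistoryAutonomyComparisonDefectRunEnclosure

/-!
# EriceRemainderEnclosureHistoryAutonomyComparisonDefectMemoryProfileRuns — (E140p) **PSEUDO-ORBITS AND RUNS OF THE PRINTED RECURSION SHAPE UNDER AN INFINITE-MEMORY ∕
# `MemoryProfile` STRUCTURE.**  (E140n) `enclosure_infinite` and (E140o) `enclosure_memoryProfile` take an arbitrary functional `B′` with `|B′ − B| ≤ ε`; by (E140i)'s trick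
# (the increments of a strictly decreasing sequence DEFINE such a functional on its own tails) they apply verbatim to `ε`-PSEUDO-ORBITS — no `B′` at all — and hence, by
# (E140j)'s index reversal, to RUNS `FlowStep.RGEqH K β g` of node U2's history-dependent recursion shape read from the infrared end.  RESULTS:
# `pseudo_orbit_enclosure_infinite`, `run_enclosure_infinite_at` (window profiles + fading tails), **`pseudo_orbit_enclosure_memoryProfile`**,
# **`run_enclosure_memoryProfile_at`** (node U2's `MemoryProfile Cm θ γ` + isotone + floor∕ceiling + `Cmγ³θ∕(1−θ)² < 1`): for a run with
# `|β_{k+1}(g_0, …, g_k) − B(g_k, …, g_0, continuation)| ≤ ε` (`k < K`),  **`1∕h₋_j² − c ≤ 1∕g_{K−j}² ≤ 1∕h₊_j² + c` for `j ≤ K`**, `c = θ₂(2ε + θ_lev·2ε∕(1−θ_lev))`,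
# independent of the run's depth — the form a β-flow seat can cite for the AS-PRINTED recursion under its own hypothesis currency.

Cell `pub-balaban`, β-function sub-cell, BINDER row D4 «RemainderConst leaves for Bałaban's split» (`HOME/BINDER-OWNERS.md`; owner lineage `b2b-balaban-beta-an4`;
this file by co-owner #2 lineage `b2b-balaban-beta-d4-p2`, generation 108), β-FLOW TEAM duty (1), FREEZE (0) honoured (def-free; (E140i) `strictAnti_of_increments` ∕
`exists_functional_of_pseudo_orbit`, (E140j) `run_increment`, (E140n) `enclosure_infinite`, (E140o) `enclosure_memoryProfile` BY NAME; nothing restated).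

HONEST FRAMING (page 1, verbatim and binding).  *"Discharging BetaPertH makes Bałaban's UV stability UNCONDITIONAL — a real constructive-QFT result; it is
NOT the continuum limit and NOT the Clay problem."*  THIS FILE DISCHARGES NOTHING OF THE KIND.  Bookkeeping over node U2's HYPOTHESIS SHAPES (`MemoryProfile`, `RGEqH`);
whether Bałaban's β_{k+1} (1.22) are `ε`-close to one isotone functional with a memory profile is NOT PRINTED ([I] p. 298; GAPS G-t4-U2-1∕-2) and NOT asserted.  Row D4
class UNCHANGED (critical-path width 0; instance 0∕1; D4 DISCHARGE NO DATE).  NOT B12 Thm 2, NOT BetaPertH, NOT continuum YM, NOT Clay.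

WHAT IS PROVED ([folklore]; 0 `def`, 0 sorry).  §1 `pseudo_orbit_enclosure_infinite`, `run_enclosure_infinite_at`.  §2 **`pseudo_orbit_enclosure_memoryProfile`**,
**`run_enclosure_memoryProfile_at`**.
-/

noncomputable section
open Finset Set Filter Topology

namespace Summit.QuantumFields.BalabanUV.Beta.EriceRemainderEnclosureHistoryAutonomyComparisonDefectMemoryProfileRuns

open Literature.MathematicalPhysics.QuantumFieldTheory.Balaban1983to89
open Literature.MathematicalPhysics.QuantumFieldTheory.Balaban1983to89.FlowStep (HBeta prefixOf RGEqH)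
open Literature.MathematicalPhysics.QuantumFieldTheory.Balaban1983to89.T4BetaStationary
open Literature.MathematicalPhysics.QuantumFieldTheory.Balaban1983to89.T4BetaFlowWellPosed
open Summit.QuantumFields.BalabanUV.Beta.EriceRemainderEnclosureHistoryAutonomyComparisonDefectPseudoOrbit
  (strictAnti_of_increments exists_functional_of_pseudo_orbit)
open Summit.QuantumFields.BalabanUV.Beta.EriceRemainderEnclosureHistoryAutonomyComparisonDefectRunEnclosure (run_increment)
open Summit.QuantumFields.BalabanUV.Beta.EriceRemainderEnclosureHistoryAutonomyComparisonDefectInfiniteMemory (enclosure_infinite)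
open Summit.QuantumFields.BalabanUV.Beta.EriceRemainderEnclosureHistoryAutonomyComparisonDefectMemoryProfile (enclosure_memoryProfile)

variable {B : (ℕ → ℝ) → ℝ} {γ b : ℝ} {β : HBeta} {g h' hlo hup : ℕ → ℝ}

/-! ## §1 Window profiles + fading tails: pseudo-orbits and runs -/

/-- **INFINITE-MEMORY PSEUDO-ORBIT ENCLOSURE**: the data of (E140n) `enclosure_infinite` for `B`, and instead of an orbit of a perturbed functional ANY box sequence `h′` from the
pin with `|1∕h′_{m+1}² − 1∕h′_m² − B(h′_{m+1}, h′_{m+2}, …)| ≤ ε` for all `m`; same conclusion. [folklore] -/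
theorem pseudo_orbit_enclosure_infinite {Λ : ℕ → ℝ} {η : ℕ → ℝ} {M βb p ε b₀ θ θ₂ : ℝ}
    (hmono : ∀ u v : ℕ → ℝ, SeqBox γ u → SeqBox γ v → (∀ i, u i ≤ v i) → B u ≤ B v)
    (hB : ∀ u u' : ℕ → ℝ, SeqBox γ u → SeqBox γ u' → ∀ D : ℝ, (∀ j, |u j - u' j| ≤ D) → |B u - B u'| ≤ M * D) (hM : 0 ≤ M)
    (hε : 0 ≤ ε) (hb₀ : 0 < b₀) (hfit : b₀ + ε < b)
    (hlow : ∀ u, SeqBox γ u → b ≤ B u) (hbdd : ∀ u, SeqBox γ u → B u ≤ βb)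
    (hΛ : ∀ k, 0 ≤ Λ k) (hS1 : ∀ K : ℕ, ∑ k ∈ range K, (k : ℝ) * Λ k ≤ θ) (hθ1 : θ < 1)
    (hS2 : ∀ K : ℕ, ∑ k ∈ range K, Λ k * ∑ l ∈ range k, ((l : ℝ) + 1) ≤ θ₂)
    (hwin : ∀ K : ℕ, ∀ u v : ℕ → ℝ, SeqBox γ u → SeqBox γ v → (∀ k : ℕ, k < K → 1 / γ ^ 2 + ((k : ℝ) + 1) * b₀ ≤ 1 / u k ^ 2) →
      (∀ k : ℕ, k < K → 1 / γ ^ 2 + ((k : ℝ) + 1) * b₀ ≤ 1 / v k ^ 2) → (∀ k : ℕ, K ≤ k → u k = v k) →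
      B u - B v ≤ ∑ k ∈ range K, Λ k * max (1 / v k ^ 2 - 1 / u k ^ 2) 0)
    (htail : ∀ K : ℕ, ∀ u v : ℕ → ℝ, SeqBox γ u → SeqBox γ v → (∀ k : ℕ, k < K → u k = v k) → |B u - B v| ≤ η K)
    (hηlim : Tendsto η atTop (𝓝 0))
    (hp : 0 < p) (hpγ : p ≤ γ) (hhlo : SeqBox γ hlo) (hflo : MemFlow (fun w => B w + -ε) p hlo)
    (hhup : SeqBox γ hup) (hfup : MemFlow (fun w => B w + ε) p hup)
    (hh' : SeqBox γ h') (hp0 : h' 0 = p)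
    (hps : ∀ m, |1 / h' (m + 1) ^ 2 - 1 / h' m ^ 2 - B (fun j => h' (m + 1 + j))| ≤ ε) (j : ℕ) :
    1 / hlo j ^ 2 - θ₂ * (2 * ε + θ * (2 * ε) / (1 - θ)) ≤ 1 / h' j ^ 2
      ∧ 1 / h' j ^ 2 ≤ 1 / hup j ^ 2 + θ₂ * (2 * ε + θ * (2 * ε) / (1 - θ)) := by
  have hinc : ∀ m, 1 / h' m ^ 2 < 1 / h' (m + 1) ^ 2 := fun m => by
    have h1 := (abs_le.mp (hps m)).1
    have h2 := hlow _ (fun j => hh' (m + 1 + j))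
    linarith
  have hanti := strictAnti_of_increments (fun m => (hh' m).1) hinc
  obtain ⟨B'', htl, hoff⟩ := exists_functional_of_pseudo_orbit hanti (fun m => 1 / h' (m + 1) ^ 2 - 1 / h' m ^ 2) B
  have hf' : MemFlow B'' p h' := ⟨hp0, fun m => by rw [htl m]; ring⟩
  have hpert : ∀ u, SeqBox γ u → |B'' u - B u| ≤ ε := by
    intro u _
    by_cases hu : ∃ m, u = fun j => h' (m + 1 + j)
    · obtain ⟨m, rfl⟩ := hu
      rw [htl m]
      exact hps m
    · rw [hoff u hu, sub_self, abs_zero]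
      exact hε
  exact enclosure_infinite hmono hB hM hε hb₀ hfit hlow hbdd hΛ hS1 hθ1 hS2 hwin htail hηlim hpert hp hpγ hhlo hflo hhup hfup hh' hf' j

/-- **INFINITE-MEMORY RUN ENCLOSURE, AT THE RUN'S OWN SCALES**: a run `RGEqH K β g` read from its infrared end (`h′_j = g_{K−j}`, `j ≤ K`; any UV continuation with
increments `ε`-close to `B`) under `|β_{k+1}(g_0, …, g_k) − B(h′_{K−k}, h′_{K−k+1}, …)| ≤ ε` (`k < K`): `1∕h₋_j² − c ≤ 1∕g_{K−j}² ≤ 1∕h₊_j² + c` for `j ≤ K`,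
`c = θ₂(2ε + θ·2ε∕(1−θ))`. [folklore] -/
theorem run_enclosure_infinite_at {Λ : ℕ → ℝ} {η : ℕ → ℝ} {M βb p ε b₀ θ θ₂ : ℝ} {K : ℕ}
    (hmono : ∀ u v : ℕ → ℝ, SeqBox γ u → SeqBox γ v → (∀ i, u i ≤ v i) → B u ≤ B v)
    (hB : ∀ u u' : ℕ → ℝ, SeqBox γ u → SeqBox γ u' → ∀ D : ℝ, (∀ j, |u j - u' j| ≤ D) → |B u - B u'| ≤ M * D) (hM : 0 ≤ M)
    (hε : 0 ≤ ε) (hb₀ : 0 < b₀) (hfit : b₀ + ε < b)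
    (hlow : ∀ u, SeqBox γ u → b ≤ B u) (hbdd : ∀ u, SeqBox γ u → B u ≤ βb)
    (hΛ : ∀ k, 0 ≤ Λ k) (hS1 : ∀ K : ℕ, ∑ k ∈ range K, (k : ℝ) * Λ k ≤ θ) (hθ1 : θ < 1)
    (hS2 : ∀ K : ℕ, ∑ k ∈ range K, Λ k * ∑ l ∈ range k, ((l : ℝ) + 1) ≤ θ₂)
    (hwin : ∀ K : ℕ, ∀ u v : ℕ → ℝ, SeqBox γ u → SeqBox γ v → (∀ k : ℕ, k < K → 1 / γ ^ 2 + ((k : ℝ) + 1) * b₀ ≤ 1 / u k ^ 2) →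
      (∀ k : ℕ, k < K → 1 / γ ^ 2 + ((k : ℝ) + 1) * b₀ ≤ 1 / v k ^ 2) → (∀ k : ℕ, K ≤ k → u k = v k) →
      B u - B v ≤ ∑ k ∈ range K, Λ k * max (1 / v k ^ 2 - 1 / u k ^ 2) 0)
    (htail : ∀ K : ℕ, ∀ u v : ℕ → ℝ, SeqBox γ u → SeqBox γ v → (∀ k : ℕ, k < K → u k = v k) → |B u - B v| ≤ η K)
    (hηlim : Tendsto η atTop (𝓝 0))
    (hp : 0 < p) (hpγ : p ≤ γ) (hhlo : SeqBox γ hlo) (hflo : MemFlow (fun w => B w + -ε) p hlo)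
    (hhup : SeqBox γ hup) (hfup : MemFlow (fun w => B w + ε) p hup)
    (hrun : RGEqH K β g) (hh' : SeqBox γ h') (hp0 : h' 0 = p) (hrev : ∀ j, j ≤ K → h' j = g (K - j))
    (hclose : ∀ k, k < K → |β k (prefixOf g k) - B (fun j => h' (K - k + j))| ≤ ε)
    (hcont : ∀ m, K ≤ m → |1 / h' (m + 1) ^ 2 - 1 / h' m ^ 2 - B (fun j => h' (m + 1 + j))| ≤ ε) {j : ℕ} (hj : j ≤ K) :
    1 / hlo j ^ 2 - θ₂ * (2 * ε + θ * (2 * ε) / (1 - θ)) ≤ 1 / g (K - j) ^ 2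
      ∧ 1 / g (K - j) ^ 2 ≤ 1 / hup j ^ 2 + θ₂ * (2 * ε + θ * (2 * ε) / (1 - θ)) := by
  rw [← hrev j hj]
  refine pseudo_orbit_enclosure_infinite hmono hB hM hε hb₀ hfit hlow hbdd hΛ hS1 hθ1 hS2 hwin htail hηlim hp hpγ hhlo hflo hhup hfup hh' hp0
    (fun m => ?_) j
  rcases lt_or_ge m K with hm | hm
  · rw [run_increment hrun hrev hm]
    have et : (fun j => h' (m + 1 + j)) = (fun j => h' (K - (K - m - 1) + j)) :=
      funext fun j => by rw [show K - (K - m - 1) = m + 1 by omega]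
    rw [et]
    exact hclose (K - m - 1) (by omega)
  · exact hcont m hm

/-! ## §2 Under node U2's memory profile -/

/-- **PSEUDO-ORBIT ENCLOSURE UNDER A MEMORY PROFILE**: the data of (E140o) `enclosure_memoryProfile` for `B` (isotone, `MemoryProfile Cm θ γ`, floor, ceiling,
`Cmγ³θ∕(1−θ)² < 1`) and ANY box sequence `h′` from the pin whose increments are within `ε` of `B` on its own tails; the enclosure with
`c = θ₂(2ε + θ_lev·2ε∕(1−θ_lev))`, `θ_lev = Cmγ³θ∕(1−θ)²`, `θ₂ = Cmγ³Σ' k, k²θ^k`. [folklore] -/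
theorem pseudo_orbit_enclosure_memoryProfile {Cm θ βb p ε : ℝ}
    (hprof : MemoryProfile Cm θ γ B) (hCm : 0 ≤ Cm) (hθ0 : 0 ≤ θ) (hθ1 : θ < 1) (hγ : 0 < γ)
    (hmono : ∀ u v : ℕ → ℝ, SeqBox γ u → SeqBox γ v → (∀ i, u i ≤ v i) → B u ≤ B v)
    (hlow : ∀ u, SeqBox γ u → b ≤ B u) (hbdd : ∀ u, SeqBox γ u → B u ≤ βb)
    (hε : 0 ≤ ε) (hεb : ε < b) (hsmall : Cm * γ ^ 3 * (θ / (1 - θ) ^ 2) < 1)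
    (hp : 0 < p) (hpγ : p ≤ γ) (hhlo : SeqBox γ hlo) (hflo : MemFlow (fun w => B w + -ε) p hlo)
    (hhup : SeqBox γ hup) (hfup : MemFlow (fun w => B w + ε) p hup)
    (hh' : SeqBox γ h') (hp0 : h' 0 = p)
    (hps : ∀ m, |1 / h' (m + 1) ^ 2 - 1 / h' m ^ 2 - B (fun j => h' (m + 1 + j))| ≤ ε) (j : ℕ) :
    1 / hlo j ^ 2 - (Cm * γ ^ 3 * ∑' k : ℕ, (k : ℝ) ^ 2 * θ ^ k)
          * (2 * ε + (Cm * γ ^ 3 * (θ / (1 - θ) ^ 2)) * (2 * ε) / (1 - Cm * γ ^ 3 * (θ / (1 - θ) ^ 2))) ≤ 1 / h' j ^ 2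
      ∧ 1 / h' j ^ 2 ≤ 1 / hup j ^ 2 + (Cm * γ ^ 3 * ∑' k : ℕ, (k : ℝ) ^ 2 * θ ^ k)
          * (2 * ε + (Cm * γ ^ 3 * (θ / (1 - θ) ^ 2)) * (2 * ε) / (1 - Cm * γ ^ 3 * (θ / (1 - θ) ^ 2))) := by
  have hinc : ∀ m, 1 / h' m ^ 2 < 1 / h' (m + 1) ^ 2 := fun m => by
    have h1 := (abs_le.mp (hps m)).1
    have h2 := hlow _ (fun j => hh' (m + 1 + j))
    linarith
  have hanti := strictAnti_of_increments (fun m => (hh' m).1) hinc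
  obtain ⟨B'', htl, hoff⟩ := exists_functional_of_pseudo_orbit hanti (fun m => 1 / h' (m + 1) ^ 2 - 1 / h' m ^ 2) B
  have hf' : MemFlow B'' p h' := ⟨hp0, fun m => by rw [htl m]; ring⟩
  have hpert : ∀ u, SeqBox γ u → |B'' u - B u| ≤ ε := by
    intro u _
    by_cases hu : ∃ m, u = fun j => h' (m + 1 + j)
    · obtain ⟨m, rfl⟩ := hu
      rw [htl m]
      exact hps m
    · rw [hoff u hu, sub_self, abs_zero]
      exact hε
  exact enclosure_memoryProfile hprof hCm hθ0 hθ1 hγ hmono hlow hbdd hε hεb hsmall hpert hp hpγ hhlo hflo hhup hfup hh' hf' j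

/-- **RUN ENCLOSURE UNDER A MEMORY PROFILE, AT THE RUN'S OWN SCALES.**  `B`: ISOTONE on `]0,γ]^ℕ` with node U2's `MemoryProfile Cm θ γ B`, floor `b ≤ B ≤ β̄`,
`Cmγ³θ∕(1−θ)² < 1`.  A run `RGEqH K β g` of node U2's history-dependent recursion shape (0.20)+p. 298, read from its infrared end (`h′_j = g_{K−j}`, `j ≤ K`) and continued into
the UV by any box sequence with increments `ε`-close to `B`; closeness **`|β_{k+1}(g_0, …, g_k) − B(h′_{K−k}, h′_{K−k+1}, …)| ≤ ε`** for `k < K` (`0 ≤ ε < b`); `h₋, h₊` box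
solutions of `B ∓ ε` from the run's infrared value.  Then for `j ≤ K`:  **`1∕h₋_j² − c ≤ 1∕g_{K−j}² ≤ 1∕h₊_j² + c`**, `c = θ₂(2ε + θ_lev·2ε∕(1−θ_lev))` — independent of the
run's depth `K`; the β-flow team's hypothesis currency throughout. [folklore] -/
theorem run_enclosure_memoryProfile_at {Cm θ βb p ε : ℝ} {K : ℕ}
    (hprof : MemoryProfile Cm θ γ B) (hCm : 0 ≤ Cm) (hθ0 : 0 ≤ θ) (hθ1 : θ < 1) (hγ : 0 < γ)
    (hmono : ∀ u v : ℕ → ℝ, SeqBox γ u → SeqBox γ v → (∀ i, u i ≤ v i) → B u ≤ B v)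
    (hlow : ∀ u, SeqBox γ u → b ≤ B u) (hbdd : ∀ u, SeqBox γ u → B u ≤ βb)
    (hε : 0 ≤ ε) (hεb : ε < b) (hsmall : Cm * γ ^ 3 * (θ / (1 - θ) ^ 2) < 1)
    (hp : 0 < p) (hpγ : p ≤ γ) (hhlo : SeqBox γ hlo) (hflo : MemFlow (fun w => B w + -ε) p hlo)
    (hhup : SeqBox γ hup) (hfup : MemFlow (fun w => B w + ε) p hup)
    (hrun : RGEqH K β g) (hh' : SeqBox γ h') (hp0 : h' 0 = p) (hrev : ∀ j, j ≤ K → h' j = g (K - j))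
    (hclose : ∀ k, k < K → |β k (prefixOf g k) - B (fun j => h' (K - k + j))| ≤ ε)
    (hcont : ∀ m, K ≤ m → |1 / h' (m + 1) ^ 2 - 1 / h' m ^ 2 - B (fun j => h' (m + 1 + j))| ≤ ε) {j : ℕ} (hj : j ≤ K) :
    1 / hlo j ^ 2 - (Cm * γ ^ 3 * ∑' k : ℕ, (k : ℝ) ^ 2 * θ ^ k)
          * (2 * ε + (Cm * γ ^ 3 * (θ / (1 - θ) ^ 2)) * (2 * ε) / (1 - Cm * γ ^ 3 * (θ / (1 - θ) ^ 2))) ≤ 1 / g (K - j) ^ 2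
      ∧ 1 / g (K - j) ^ 2 ≤ 1 / hup j ^ 2 + (Cm * γ ^ 3 * ∑' k : ℕ, (k : ℝ) ^ 2 * θ ^ k)
          * (2 * ε + (Cm * γ ^ 3 * (θ / (1 - θ) ^ 2)) * (2 * ε) / (1 - Cm * γ ^ 3 * (θ / (1 - θ) ^ 2))) := by
  rw [← hrev j hj]
  refine pseudo_orbit_enclosure_memoryProfile hprof hCm hθ0 hθ1 hγ hmono hlow hbdd hε hεb hsmall hp hpγ hhlo hflo hhup hfup hh' hp0 (fun m => ?_) j
  rcases lt_or_ge m K with hm | hm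
  · rw [run_increment hrun hrev hm]
    have et : (fun j => h' (m + 1 + j)) = (fun j => h' (K - (K - m - 1) + j)) :=
      funext fun j => by rw [show K - (K - m - 1) = m + 1 by omega]
    rw [et]
    exact hclose (K - m - 1) (by omega)
  · exact hcont m hm

end Summit.QuantumFields.BalabanUV.Beta.EriceRemainderEnclosureHistoryAutonomyComparisonDefectMemoryProfileRuns

end
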